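import Mathlib
import HarnessLib
import Summits.HubbardSuperconductivity.HubbardSuperconductivity.Theorems.ComplexGFFStiffnessHypACumulantHolomorphicNextK

/-!
# Crux `HypACumulant`, line `gnv` — structural pass, S6a assembled: the renormalisation map
# `K_{k+1} = nextKStep D H K` ([ABKM19] Definition 6.5) is holomorphic along every complex line
# `(H + σU, K + σV)`, pointwise in the polymer and the field

Route `route-HubbardSuperconductivity-ComplexGFFStiffness`, cruxes stmt-HubbardSuperconductivity-19154 /
-19155, shared research statement `OnePointLipschitz`, census (C3d′) (memo §8).  Combination of
`nextH_line` (the intermediate Hamiltonian is affine along the line) and `differentiableOn_nextK_line`: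

* **`differentiableOn_nextKStep_line`** — under (i) the step-data hypotheses of `nextH_eq` (positive
  semidefinite circulant kernel, nonempty reference block with room), (ii) integrability of
  `K(B₀, φ+·)`, `V(B₀, φ+·)` for `μ_{k+1}` and `C²` of their fluctuation integrals, (iii) measurability and a
  `σ`-uniform `μ_{k+1}`-integrable bound of the intermediate functional `Φ_σ(X, φ, ·)` on the disc, the map
  `σ ↦ nextKStep D (H + σU) (K + σV) U' φ` is holomorphic on the disc `|σ| < R`.

This is input (1) of the recipe of memo §8 (then `…HolomorphicPointwise` and `…HolomorphicCoeffPolymerNorm`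
give the `(H,K)`-Lipschitz and parallelogram bounds of `S_k` from the zeroth-order Theorem 6.8 bound).
Hypotheses (ii)–(iii) are discharged for the torus data by the tree's `opBHom`/`FlowStepIntegrability`
lemmas (next generation).  All proved, no `sorry`.

## References
* S. Adams, S. Buchholz, R. Kotecký, S. Müller, arXiv:1910.13564, Definition 6.5 (6.16), (6.34)
  [AdamsBuchholzKoteckyMuller2019].
-/

noncomputable section

-- `Summit.<Summit>.<Problem>`: single-conjunct summit, the duplicate component is mandated (D-0017).
set_option linter.dupNamespace false

namespace Summit.HubbardSuperconductivity.HubbardSuperconductivity.Theorems.ComplexGFF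

open MeasureTheory Metric Set
open Literature.MathematicalPhysics.StatisticalMechanics.GradientRG
open Literature.MathematicalPhysics.StatisticalMechanics.TorusPolymer (bprod blocks pcirc polys reblock)
open Literature.MathematicalPhysics.StatisticalMechanics

variable {d M : ℕ} [NeZero M]

/-- **`K_{k+1} = nextKStep D H K` is holomorphic along the line `(H + σU, K + σV)`** (pointwise in `U', φ`). -/
theorem differentiableOn_nextKStep_line (D : StepData d M) (hC : (Matrix.circulant D.𝒞).PosSemidef)
    (hB : D.B₀.card ≠ 0) (hroom : ∀ x ∈ D.B₀, HasRoom D.c₀ x (d / 2 + 1)) (H U : RelevantHamiltonian ℂ d)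
    {K V : Finset (Fin d → ZMod M) → ((Fin d → ZMod M) → ℝ) → ℂ}
    (hKi : ∀ φ, Integrable (fun ξ => K D.B₀ (φ + ξ)) (stepMeasure D.𝒞))
    (hVi : ∀ φ, Integrable (fun ξ => V D.B₀ (φ + ξ)) (stepMeasure D.𝒞))
    (hKd : ContDiff ℝ 2 (fluct D.𝒞 (K D.B₀))) (hVd : ContDiff ℝ 2 (fluct D.𝒞 (V D.B₀)))
    (U' : Finset (Fin d → ZMod M)) (φ : (Fin d → ZMod M) → ℝ) {R : ℝ}
    (hmeas : ∀ X σ, AEStronglyMeasurable (fun ξ =>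
      midK D.s (expNegH (H + σ • U)) (expNegH (nextH D H K + σ • nextH D U V))
        (fun Y ψ => K Y ψ + σ * V Y ψ) X φ ξ) (stepMeasure D.𝒞))
    (hdom : ∀ X, ∃ G : ((Fin d → ZMod M) → ℝ) → ℝ, Integrable G (stepMeasure D.𝒞) ∧ ∀ σ ∈ ball (0 : ℂ) R, ∀ ξ,
      ‖midK D.s (expNegH (H + σ • U)) (expNegH (nextH D H K + σ • nextH D U V))
        (fun Y ψ => K Y ψ + σ * V Y ψ) X φ ξ‖ ≤ G ξ) :
    DifferentiableOn ℂ (fun σ : ℂ => nextKStep D (H + σ • U) (fun Y ψ => K Y ψ + σ * V Y ψ) U' φ) (ball (0 : ℂ) R) := by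
  have e : ∀ σ : ℂ, nextKStep D (H + σ • U) (fun Y ψ => K Y ψ + σ * V Y ψ) U' φ
      = nextK D.s (reblock D.s (D.L * D.s)) (stepMeasure D.𝒞) (expNegH (H + σ • U))
          (expNegH (nextH D H K + σ • nextH D U V)) (fun Y ψ => K Y ψ + σ * V Y ψ) U' φ := by
    intro σ
    unfold nextKStep
    rw [nextH_line D hC hB hroom H U hKi hVi hKd hVd σ]
  simp only [e]
  exact differentiableOn_nextK_line D.s _ _ H U (nextH D H K) (nextH D U V) K V U' φ hmeas hdom

end Summit.HubbardSuperconductivity.HubbardSuperconductivity.Theorems.ComplexGFF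

end
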